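import Summits.Ventures.HodgeRepro2.T5SU11ResolventDiagonal
import Summits.Ventures.HodgeRepro2.T5SU11SphericalReflection

/-!
# The diagonalisation of the resolvent for every spectral parameter `2 − λ < λ′ < λ`, `λ′ ≠ 1`

Row 470 diagonalised the resolvent `G_λ` (`λ > 1`) on the spherical functions `φ_{λ′}` with `1 < λ′ < λ`. Since
`φ_{λ′} = φ_{2−λ′}` and `λ′(λ′−2) = (2−λ′)((2−λ′)−2)` (row 466), the same identity holds for `2 − λ < λ′ < 1`
(`resolvent_transform_of_lt_one`, `sphTransform_sphGreen_of_lt_one`), hence for **every `λ′ ∈ (2−λ, λ)` other than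
the edge `λ′ = 1`** (`resolvent_transform_of_ne_one`, `sphTransform_sphGreen_of_ne_one`):

  **`∫_{(0,∞)} (G_λ f) φ_{λ′} sinh 2t = (∫_{(0,∞)} f φ_{λ′} sinh 2t) / (λ′(λ′−2) − λ(λ−2))`**,

with `λ′(λ′−2) − λ(λ−2) = (λ′−1)² − (λ−1)² < 0` on the whole window `|λ′ − 1| < λ − 1` (`mu_sub_mu_neg_of_abs_lt`).
The window is exactly the strip in which `φ_{λ′} χ_λ sinh 2t ~ e^{(|λ′−1| − (λ−1))t}` is integrable; the edge
`λ′ = 1` (`φ_1 = Ξ`) is not covered here. Nothing is claimed about (N).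

Blind lane: Mathlib + the HodgeRepro2 prefix only; no sorry; axioms ⊆ {propext, Classical.choice,
Quot.sound}.
-/

namespace Summit.Ventures.HodgeRepro2.T5SU11ResolventDiagonalReflect

open MeasureTheory intervalIntegral
open Set (Ioi)
open T5SU11Cartan T5SU11SphericalFunction T5SU11SphericalSymmetry T5SU11SphericalGreen
  T5SU11SphericalReflection T5SU11ResolventDiagonal

/-- `λ′(λ′−2) − λ(λ−2) = (λ′−1)² − (λ−1)² < 0` for `|λ′ − 1| < λ − 1`. -/
theorem mu_sub_mu_neg_of_abs_lt {lam lam' : ℝ} (h : |lam' - 1| < lam - 1) :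
    lam' * (lam' - 2) - lam * (lam - 2) < 0 := by
  have h0 : 0 ≤ |lam' - 1| := abs_nonneg _
  have hsq : (lam' - 1) ^ 2 < (lam - 1) ^ 2 := by
    rw [← sq_abs (lam' - 1)]
    exact pow_lt_pow_left₀ h h0 (by norm_num)
  nlinarith [hsq]

/-- The window `2 − λ < λ′ < λ` is the strip `|λ′ − 1| < λ − 1`. -/
theorem abs_sub_one_lt_iff {lam lam' : ℝ} : |lam' - 1| < lam - 1 ↔ 2 - lam < lam' ∧ lam' < lam := by
  rw [abs_sub_lt_iff]
  constructor <;> rintro ⟨h1, h2⟩ <;> constructor <;> linarith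

section measure

variable [MeasurableSpace Circle] [BorelSpace Circle]

variable {lam lam' a b : ℝ} {f : ℝ → ℝ} (hf : ContinuousOn f (Ioi 0))
  (ha : 0 < a) (hab : a ≤ b) (hfa : ∀ s, s ≤ a → f s = 0) (hfb : ∀ s, b ≤ s → f s = 0)

include hf ha hab hfa hfb in
/-- **The diagonalisation for `2 − λ < λ′ < 1`** (by the reflection `φ_{λ′} = φ_{2−λ′}`). -/
theorem resolvent_transform_of_lt_one (h1 : 2 - lam < lam') (h2 : lam' < 1) :
    (lam' * (lam' - 2) - lam * (lam - 2))
        * ∫ t in Ioi 0, sphGreen lam f a b t * sph lam' (hyp t) * Real.sinh (2 * t)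
      = ∫ t in a..b, f t * sph lam' (hyp t) * Real.sinh (2 * t) := by
  have h := resolvent_transform (lam := lam) (lam' := 2 - lam') (by linarith) (by linarith) hf ha hab hfa hfb
  have e : ∀ t, sph (2 - lam') (hyp t) = sph lam' (hyp t) := fun t => (sph_two_sub_hyp lam' t).symm
  simp only [e, mul_sub_two_two_sub] at h
  exact h

include hf ha hab hfa hfb in
/-- **The eigenvalue form for `2 − λ < λ′ < 1`.** -/
theorem sphTransform_sphGreen_of_lt_one (h1 : 2 - lam < lam') (h2 : lam' < 1) :
    ∫ t in Ioi 0, sphGreen lam f a b t * sph lam' (hyp t) * Real.sinh (2 * t)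
      = (∫ t in Ioi 0, f t * sph lam' (hyp t) * Real.sinh (2 * t)) / (lam' * (lam' - 2) - lam * (lam - 2)) := by
  have h := sphTransform_sphGreen (lam := lam) (lam' := 2 - lam') (by linarith) (by linarith) hf ha hab hfa hfb
  have e : ∀ t, sph (2 - lam') (hyp t) = sph lam' (hyp t) := fun t => (sph_two_sub_hyp lam' t).symm
  simp only [e, mul_sub_two_two_sub] at h
  exact h

include hf ha hab hfa hfb in
/-- **The diagonalisation on the whole window `2 − λ < λ′ < λ`, `λ′ ≠ 1`.** -/
theorem resolvent_transform_of_ne_one (h1 : 2 - lam < lam') (h2 : lam' < lam) (hne : lam' ≠ 1) :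
    (lam' * (lam' - 2) - lam * (lam - 2))
        * ∫ t in Ioi 0, sphGreen lam f a b t * sph lam' (hyp t) * Real.sinh (2 * t)
      = ∫ t in a..b, f t * sph lam' (hyp t) * Real.sinh (2 * t) := by
  rcases lt_or_gt_of_ne hne with h | h
  · exact resolvent_transform_of_lt_one hf ha hab hfa hfb h1 h
  · exact resolvent_transform h h2 hf ha hab hfa hfb

include hf ha hab hfa hfb in
/-- **The eigenvalue form on the whole window**: `(G_λ f)^(λ′) = f̂(λ′)/(λ′(λ′−2) − λ(λ−2))` for `|λ′ − 1| < λ − 1`,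
`λ′ ≠ 1`. -/
theorem sphTransform_sphGreen_of_ne_one (h1 : 2 - lam < lam') (h2 : lam' < lam) (hne : lam' ≠ 1) :
    ∫ t in Ioi 0, sphGreen lam f a b t * sph lam' (hyp t) * Real.sinh (2 * t)
      = (∫ t in Ioi 0, f t * sph lam' (hyp t) * Real.sinh (2 * t)) / (lam' * (lam' - 2) - lam * (lam - 2)) := by
  rcases lt_or_gt_of_ne hne with h | h
  · exact sphTransform_sphGreen_of_lt_one hf ha hab hfa hfb h1 h
  · exact sphTransform_sphGreen h h2 hf ha hab hfa hfb

end measure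

end Summit.Ventures.HodgeRepro2.T5SU11ResolventDiagonalReflect
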